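import Literature.NumberTheory.CubicFields.ThreeTorsionBridge
import Literature.NumberTheory.CubicFields.MaximalCubicRings
import Literature.NumberTheory.CubicFields.CubicFieldForms
import Literature.NumberTheory.CubicFields.SubringForms
import Literature.NumberTheory.CubicFields.ReducibleMaximality
import Literature.NumberTheory.CubicFields.DeloneFaddeevFractionField
import Literature.NumberTheory.QuadraticFields.FundamentalDiscriminant
import Literature.Computability.Cryptography.HallgrenClassGroup

/-!
# Stub `stub_cubicFieldAP` of line `Sketch` (v2) for the crux `ArithStatLadder.IqThreeNotPPoly`

For the planted one-parameter family of binary cubic forms `f = x³ − x²y + e y³ = ⟨1, −1, 0, e⟩`,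
`e = N t`, `t = 1 + 2Nk`, one has `Disc f = 4e − 27e² = −d` with `d = N t (27 N t − 4)`. If `−d` is a
negative FUNDAMENTAL discriminant then there is a cubic number field of discriminant exactly `−d`,
so `cubicFieldCountOfDisc (−d) ≥ 1`.

Mathematics.
* `f` is irreducible over `ℚ`: `f` is monic in `x`, so a rational zero is an integral zero `(m, 1)`,
  i.e. `m³ − m² + e = 0`, `e = M² (M + 1)` with `M = −m ≥ 1` (as `e ≥ 1`). Then `−d = −e (27 e − 4)`
  is divisible by the square `25` (`M = 1`, `d = 100`), `16` (`M = 2`, `d = 3840`) or `M² ≥ 9`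
  (`M ≥ 3`) — impossible for a fundamental discriminant, whose square divisors are `1` and `4`
  (tree: `Quadratic.sq_eq_one_or_four_of_sq_dvd`).
* `K = ℚ[x]/(f(x,1))` is a cubic number field (tree: `RatAlgebra`, `finrank_ratAlgebra_eq_three`),
  `R(f) ↪ 𝓞 K ≅ R(g)` (tree: `toRingOfIntegers`, `exists_ringOfForm_ringEquiv_ringOfIntegers`) with
  `Disc f = D² · Disc g = D² · discr K` (tree: `disc_eq_detOnQuot_sq_mul`,
  `disc_eq_discr_of_ringEquiv_ringOfIntegers`). Again `D² ∈ {1, 4}`, and `D² = 4` is impossible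
  because `Disc g ≡ 0, 1 (mod 4)` (tree: `BinaryCubic.disc_emod_four`,
  `Int.not_isFundamental_of_eq_sq_mul`). Hence `discr K = Disc f = −d` and
  `one_le_cubicFieldCountOfDisc` concludes.
-/

set_option linter.dupNamespace false -- D-0017: single-problem summit ⇒ `QuantumAdvantage.QuantumAdvantage` by design

noncomputable section

namespace Summit.QuantumAdvantage.QuantumAdvantage.Theorems.IqThreeNotPPoly

open scoped Classical
open Polynomial
open Literature.Computability.Cryptography (IsNegFundamentalDiscr)
open Literature.NumberTheory.QuadraticFields
open Literature.NumberTheory.CubicFields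

/-! ### Cubic fields from irreducible forms of fundamental discriminant -/

/-- **An irreducible form of fundamental discriminant gives a cubic field of that discriminant.**
For `f` irreducible over `ℚ` with `Disc f` a fundamental discriminant, the cubic field
`K_f = ℚ[x]/(f(x,1))` has `discr K_f = Disc f`: `R(f) ↪ 𝓞 K_f ≅ R(g)` has index `D` with
`Disc f = D² Disc g = D² discr K_f`; `D² ∣ Disc f` forces `D² ∈ {1, 4}`, and `D² = 4` would make
`Disc f = 2² · Disc g` with `Disc g ≡ 0, 1 (mod 4)` non-fundamental. Hence
`cubicFieldCountOfDisc (Disc f) ≥ 1`. -/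
theorem one_le_cubicFieldCountOfDisc_of_isFundamental {f : BinaryCubic ℤ} (hf : f.IsIrreducible)
    (hfund : (f.disc % 4 = 1 ∧ Squarefree f.disc ∧ f.disc ≠ 1) ∨
      (4 ∣ f.disc ∧ (f.disc / 4 % 4 = 2 ∨ f.disc / 4 % 4 = 3) ∧ Squarefree (f.disc / 4))) :
    1 ≤ cubicFieldCountOfDisc f.disc := by
  haveI : Fact f.IsIrreducible := ⟨hf⟩
  obtain ⟨g, ⟨e⟩⟩ := exists_ringOfForm_ringEquiv_ringOfIntegers (K := RingOfForm.RatAlgebra f)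
    RingOfForm.finrank_ratAlgebra_eq_three
  have hφ : Function.Injective (e.symm.toRingHom.comp (RingOfForm.toRingOfIntegers f)) :=
    e.symm.injective.comp RingOfForm.toRingOfIntegers_injective
  have h1 := RingOfForm.disc_eq_detOnQuot_sq_mul _ hφ
  have h2 : g.disc = NumberField.discr (RingOfForm.RatAlgebra f) :=
    disc_eq_discr_of_ringEquiv_ringOfIntegers RingOfForm.finrank_ratAlgebra_eq_three e
  have hK : NumberField.discr (RingOfForm.RatAlgebra f) = f.disc := by
    rcases Quadratic.sq_eq_one_or_four_of_sq_dvd hfund ⟨g.disc, h1⟩ with h | h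
    · rw [← h2, h1, h, one_mul]
    · exfalso
      refine Int.not_isFundamental_of_eq_sq_mul Nat.prime_two ?_ (BinaryCubic.disc_emod_four g) hfund
      rw [h1, h]
      norm_num
  rw [← hK]
  exact one_le_cubicFieldCountOfDisc (RingOfForm.RatAlgebra f) RingOfForm.finrank_ratAlgebra_eq_three

/-! ### The planted form `x³ − x²y + e y³` -/

/-- A binary cubic form that is monic in `x` (`a = 1`) and reducible over `ℚ` has an INTEGRAL zero
`(m, 1)`: a rational zero in lowest terms `(num, den)` has `den ∣ num³`, so `den = 1`. -/
theorem exists_eval_eq_zero_of_not_isIrreducible {f : BinaryCubic ℤ} (ha : f.a = 1)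
    (h : ¬ f.IsIrreducible) : ∃ m : ℤ, f.eval m 1 = 0 := by
  have ha0 : f.a ≠ 0 := by rw [ha]; exact one_ne_zero
  have hred : ¬ Irreducible f.ratPoly := fun hi => h ⟨ha0, hi⟩
  rw [irreducible_iff_roots_eq_zero_of_degree_le_three
      (by rw [BinaryCubic.natDegree_ratPoly ha0]; norm_num) (BinaryCubic.natDegree_ratPoly ha0).le]
    at hred
  obtain ⟨r, hr⟩ := Multiset.exists_mem_of_ne_zero hred
  have hroot : f.ratPoly.eval r = 0 := (mem_roots (BinaryCubic.ratPoly_ne_zero ha0)).mp hr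
  have h0 : f.eval r.num r.den = 0 := BinaryCubic.eval_num_den_eq_zero hroot
  have hcop : IsCoprime r.num (r.den : ℤ) :=
    Int.isCoprime_iff_nat_coprime.mpr (by simpa using r.reduced)
  have hdvd : (r.den : ℤ) ∣ r.num ^ 3 := by
    refine ⟨-(f.b * r.num ^ 2 + f.c * r.num * r.den + f.d * (r.den : ℤ) ^ 2), ?_⟩
    rw [BinaryCubic.eval, ha] at h0
    linear_combination h0
  have hunit : IsUnit (r.den : ℤ) := hcop.pow_left.isUnit_of_dvd' hdvd dvd_rfl
  have hden : (r.den : ℤ) = 1 := by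
    rcases Int.isUnit_iff.mp hunit with h1 | h1
    · exact h1
    · have := r.den_pos
      omega
  rw [hden] at h0
  exact ⟨r.num, h0⟩

/-- An integral zero `(m, 1)` of `x³ − x²y + e y³` with `e ≥ 1` forces `e = M² (M + 1)` with
`M = −m ≥ 1`. -/
theorem exists_eq_sq_mul_succ_of_eval_eq_zero {e m : ℤ} (he : 0 < e)
    (h : (⟨1, -1, 0, e⟩ : BinaryCubic ℤ).eval m 1 = 0) :
    ∃ M : ℕ, 1 ≤ M ∧ e = (M : ℤ) ^ 2 * ((M : ℤ) + 1) := by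
  simp only [BinaryCubic.eval] at h
  have he' : e = m ^ 2 * (1 - m) := by linear_combination h
  have hm : m ≤ -1 := by
    by_contra hlt
    rcases (show m = 0 ∨ 1 ≤ m by omega) with rfl | h1
    · norm_num at he'
      omega
    · nlinarith [sq_nonneg m]
  obtain ⟨M, hM⟩ := Int.eq_ofNat_of_zero_le (show 0 ≤ -m by omega)
  refine ⟨M, by omega, ?_⟩
  rw [show m = -(M : ℤ) by omega] at he'
  linear_combination he'

/-- If `e = M² (M + 1)` with `M ≥ 1` and `d = e (27 e − 4)` then `−d` is not a negative fundamental
discriminant: `−d` is divisible by the square `25` (`M = 1`, `d = 100`), `16` (`M = 2`, `d = 3840`)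
or `M² ≥ 9` (`M ≥ 3`), whereas the square divisors of a fundamental discriminant are `1` and `4`. -/
theorem not_isNegFundamentalDiscr_of_planted_root {M d : ℕ} {e : ℤ} (hM : 1 ≤ M)
    (he : e = (M : ℤ) ^ 2 * ((M : ℤ) + 1)) (hd : (d : ℤ) = e * (27 * e - 4)) :
    ¬ IsNegFundamentalDiscr d := by
  intro hfund
  obtain ⟨x, hx, hx4⟩ : ∃ x : ℤ, x ^ 2 ∣ -(d : ℤ) ∧ 4 < x ^ 2 := by
    subst he
    rw [hd]
    rcases (show M = 1 ∨ M = 2 ∨ 3 ≤ M by omega) with rfl | rfl | hM3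
    · exact ⟨5, ⟨-4, by norm_num⟩, by norm_num⟩
    · exact ⟨4, ⟨-240, by norm_num⟩, by norm_num⟩
    · have h3 : (3 : ℤ) ≤ M := by exact_mod_cast hM3
      exact ⟨M, ⟨-(((M : ℤ) + 1) * (27 * ((M : ℤ) ^ 2 * ((M : ℤ) + 1)) - 4)), by ring⟩,
        by nlinarith⟩
  rcases Quadratic.sq_eq_one_or_four_of_sq_dvd (d := -(d : ℤ)) hfund hx with h | h <;> linarith

/-- **The planted form gives a cubic field of discriminant `−d`.** For `e ≥ 1` and
`d = e (27 e − 4)` with `−d` a negative fundamental discriminant, the form `x³ − x²y + e y³` is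
irreducible (a zero would make `−d` non-fundamental, `not_isNegFundamentalDiscr_of_planted_root`)
and `Disc = 4e − 27e² = −d`, whence `cubicFieldCountOfDisc (−d) ≥ 1`
(`one_le_cubicFieldCountOfDisc_of_isFundamental`). -/
theorem one_le_cubicFieldCountOfDisc_of_planted {e : ℤ} {d : ℕ} (he : 0 < e)
    (hd : (d : ℤ) = e * (27 * e - 4)) (hfund : IsNegFundamentalDiscr d) :
    1 ≤ cubicFieldCountOfDisc (-(d : ℤ)) := by
  have hirr : (⟨1, -1, 0, e⟩ : BinaryCubic ℤ).IsIrreducible := by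
    by_contra h
    obtain ⟨m, hm⟩ := exists_eval_eq_zero_of_not_isIrreducible rfl h
    obtain ⟨M, hM, hMe⟩ := exists_eq_sq_mul_succ_of_eval_eq_zero he hm
    exact not_isNegFundamentalDiscr_of_planted_root hM hMe hd hfund
  have hdisc : (⟨1, -1, 0, e⟩ : BinaryCubic ℤ).disc = -(d : ℤ) := by
    rw [hd]
    simp only [BinaryCubic.disc_eq]
    ring
  rw [← hdisc]
  exact one_le_cubicFieldCountOfDisc_of_isFundamental hirr (by rw [hdisc]; exact hfund)

/-- **Stub C · `stub_cubicFieldAP`.** For squarefree `N` (so `N ≥ 1`), `t = 1 + 2Nk` and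
`d = N t (27 N t − 4) = |Disc (x³ − x²y + N t·y³)|`: if `−d` is a negative fundamental discriminant
then there is a cubic number field of discriminant `−d` (namely `ℚ[x]/(x³ − x² + N t)`, whose order
`R(f)` is then maximal), i.e. `cubicFieldCountOfDisc (−d) ≥ 1`. -/
theorem stub_cubicFieldAP :
    ∀ (N k : ℕ), Squarefree N →
      IsNegFundamentalDiscr (N * (1 + 2 * N * k) * (27 * N * (1 + 2 * N * k) - 4)) →
        1 ≤ cubicFieldCountOfDisc (-((N * (1 + 2 * N * k) * (27 * N * (1 + 2 * N * k) - 4) : ℕ) : ℤ)) := by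
  intro N k hN hfund
  have hN1 : 1 ≤ N := Nat.one_le_iff_ne_zero.mpr hN.ne_zero
  have h4 : 4 ≤ 27 * N * (1 + 2 * N * k) := by
    have := Nat.mul_le_mul (Nat.mul_le_mul_left 27 hN1) (show 1 ≤ 1 + 2 * N * k by omega)
    omega
  have hN0 : (0 : ℤ) < N := by exact_mod_cast hN1
  refine one_le_cubicFieldCountOfDisc_of_planted (e := (N : ℤ) * (1 + 2 * N * k))
    (mul_pos hN0 (by positivity)) ?_ hfund
  push_cast [Nat.cast_sub h4]
  ring

end Summit.QuantumAdvantage.QuantumAdvantage.Theorems.IqThreeNotPPoly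

end
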